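import Summits.AtomisticToContinuum.Crystallization.Theses.ThreeConeCertificate

/-!
# Route `ThreeConeCertificate` — `Assembly` (stmt-AtomisticToContinuum-11966)

`Assembly := ExactCertificate → SlackRigidity → CertificateBound → EnergeticHalf → TrialStateUpper →
SlackToBulk → DefectVanishCrystallizes → Crystallization` is the route's deciding implication with
the unused hypotheses of `closes` dropped. `Crystallization` (the sub-problem statement, an
abbreviation of `Literature.MathematicalPhysics.StatisticalMechanics.Crystallization`) is the
conjunction `HasPeriodicGroundStateEnergy lennardJones 3 ∧ IsCrystallizing lennardJones 3`
(Blanc–Lewin 2015, §2.1):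

* conjunct (i) is `EnergeticHalf` applied to the Kepler bound `CertificateBound ExactCertificate`
  and to `TrialStateUpper`;
* conjunct (ii) is `DefectVanishCrystallizes` applied to the hinge `SlackToBulk SlackRigidity` and to
  the PROVED Literature theorem `LennardJonesMinimalDistance_holds` (uniform minimal distance
  `δ = 1/3` of Lennard-Jones ground states), discharged inside the proof exactly as in `closes`.

Pure logic over the route's definitions. [folklore]
-/

namespace Summit.AtomisticToContinuum.Crystallization.Theorems

open Literature.MathematicalPhysics.StatisticalMechanics

/-- Settles `stmt-AtomisticToContinuum-11966` (`Assembly` of route `ThreeConeCertificate`):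
`ExactCertificate → SlackRigidity → CertificateBound → EnergeticHalf → TrialStateUpper → SlackToBulk →
DefectVanishCrystallizes → Crystallization`. Conjunct (i) `HasPeriodicGroundStateEnergy` is
`EnergeticHalf (CertificateBound ExactCertificate) TrialStateUpper`; conjunct (ii) `IsCrystallizing`
is `DefectVanishCrystallizes (SlackToBulk SlackRigidity) LennardJonesMinimalDistance_holds`, the
minimal-distance fact being the proved tree theorem (no extra hypothesis). Same term as the route's
`closes`. [folklore] -/
theorem threeConeCertificate_assembly_proof :
    Summit.AtomisticToContinuum.Crystallization.Theses.ThreeConeCertificate.Assembly := by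
  unfold Theses.ThreeConeCertificate.Assembly
  intro hE hS hCB hEH hTU hStB hDVC
  exact ⟨hEH (hCB hE) hTU, hDVC (hStB hS) LennardJonesMinimalDistance_holds⟩

end Summit.AtomisticToContinuum.Crystallization.Theorems
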